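/-
Copyright (c) 2026 the pub-hodgecm-mathlib formalisation cell (harness21).  Prover seat hodgecm-mathlib-LH7-p10 (g0), req620 Track A «(D-RAM) FOUR-FRAME» squad
(STAGE-1b, row (2) of the piece `f_{T₊}`, the (β₂) road (R-36)∕T20-19∕T20-20 «PURE-CELL LEDGER, RELATIVE SIGNS», RamM rows (K-a)(K-b)(K-c); β₂ sub-dealer LH4-p04 (g8)
`BETA2-BOARD.v1.1`; refuter LH4-cdis1 (g0) `BETA2-CELLCHECK.v1` cf94291e §1b + 15:28:14Z; the RamM twin of ★ p861334 ∕ ★ p861408), 2026-09-04.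
-/
import Summits.HodgeConjecture.HodgeConjecture.Theorems.F0P3cDyRamToricCensusSumRamMWeldOfFrame   -- ★ (LH4-p04 (g5)) (C-3′): brings ★ T5c tables `ncard_levelSet_eq_hnP∕hnM`, ★ `exists_thirdFieldPackage_ramM`, ★ class letters, ★ `levelSetDep_eq_of_generic_ramified`, ★ DEFS
import HarnessLib

/-!
# Crux `H413`, line LH4 «(D-RAM) FOUR-FRAME» — STAGE-1b, row (2), the (β₂) road, THE SIZES OF THE PURE-CELL LEDGER, TYPE RamM (the lane of the ℚ₂(√2), c = −1 keys):
# «the two ★ T5c tables AT THE FRAME (class letters and third field discharged), the row readers — DIAGONAL `k = −1`: `q^j`, NEAR `k + 2 < 2g`: `(q−1)q^{j−1−k∕2}`, BOUNDARY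
#  `k + 2 = 2g`: `(q−2)q^{j−1−k∕2}` ∕ `q^{j−k∕2}`, FAR: `2(q−1)q^{j−1−k∕2}` ∕ `0` (`k = j − a − s0`; hyperbolic ∕ anisotropic) — and the low-cell depth reduction»

Cell `hodgecm-mathlib` (D-0151), FLOOR 0, crux item H413 = `stmt-HodgeConjecture-24833`, route of record `HCCMUnconditional`; squad F0∕P3c∕LH4; lane
`--supports stmt-HodgeConjecture-24833 --as helper` (count-neutral; pays NO tier-0 row).  THEOREMS ONLY (no `def`, no instance, no notation, no `sorry`, default heartbeats);
★-only imports; states NO law; (β₂) stays a HYPOTHESIS.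

WHY (heir LEAD T20-19∕T20-20 RamM rows (K-a) `D₂ = −D₁`, (K-b) `K₀ = ±D`, (K-c) tower recursion; LH4-cdis1 (g0) §1b: at the ℚ₂(√2), c = −1 keys — type RamM, `(g, s0) = (2, 1)` by ★
ALIGN-T2CELLS v1 — the pure cells are `D = ((m−1)∕2, (m−1)∕2)` (the `k = −1` diagonal), `K₀ = ((m+1)∕2, (m−1)∕2)` (`k = 0`), and a tower, with `|D| = |K₀| = 2^{ρ₁₃−1}`, first
tower cell `4·|D|`).  As in the RamK lane (★ p861334 ∕ ★ p861408) every size is «THE WHOLE CELL AT FULL WEIGHT», read off the ★ T5c tables: with `k := j − a − s0`, tube depth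
`a`, `m = v_{ϖE}(lam − jE u₀₀) = ρ₁₃`: `#D = q^j` (row `k = −1`, BOTH literals), `#K₀ = (q−1)q^{j−1}` (row `k = 0 < 2g − 2`, both), tower `k = 2, 4, …`: near ∕ boundary ∕ far rows
— weighted by ★ cone weight `q^a`: `q^{2a+s0−1}`, `(q−1)q^{2a+s0−1}`, … = `2^{ρ₁₃−1}`, `2^{ρ₁₃−1}`, `4·2^{ρ₁₃−1}` (boundary, anisotropic) at `q = 2, s0 = 1, g = 2` ✓ cdis1 to the digit.
THIS FILE (★ bricks only, one abstract dyadic field `K`; frame letters ⊆ ★ (C-3′) `toricCensusSum_ramM_weld_of_frame`'s):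
* §1 THE TWO ★ T5c TABLES AT THE FRAME — `ncard_levelSet_ramM_hyper_of_frame` ∕ `ncard_levelSet_ramM_aniso_of_frame`: ★ p858235 `ncard_levelSet_eq_hnP` ∕ ★ p858252
  `ncard_levelSet_eq_hnM` with the third-field package (★ p857945 `exists_thirdFieldPackage_ramM`) and the class letters (★ p858341 `hcls0_ramM ∕ hclsT_ramM ∕ hclsO_ramM ∕
  hclsE_ramM`) DISCHARGED from the frame letters — exactly the (C-0c)(C-1cls)(C-1) steps of ★ (C-3′), now reusable heads (the if-ladders VERBATIM).
* §2 THE ROW READERS (binder-light corollaries, `a ≥ 1`): DIAGONAL `j + 1 = a + s0`: `q^j` for every Θ-fixed `h` (`ncard_levelSet_diag_ramM`); NEAR `a + s0 ≤ j`, `j + 2 < a + s0 + 2g`,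
  `k` even: `(q−1)·q^{j−1−k∕2}` for every `h` (`ncard_levelSet_near_ramM`); BOUNDARY `j + 2 = a + s0 + 2g`: hyperbolic `(q−2)·q^{j−1−k∕2}` (ZERO at q = 2 only), anisotropic
  `q^{j−k∕2}`; FAR `a + s0 + 2g ≤ j`, `k` even: hyperbolic `2(q−1)·q^{j−1−k∕2}`, anisotropic `0`.
* §3 THE LOW-CELL DEPTH REDUCTION with the RamM tokens `|μ| = |ϖE|^m`, `|μ − ρμ| = |ϖE^{jl}·(ϖM − ρϖM)|` (★ `levelSetDep_eq_of_generic_ramified`): `levelSetDep(j, a; μ) = levelSet(j, a)`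
  for `2a ≤ m`, `j + a ≤ jl` (`levelSetDep_eq_levelSet_of_add_le_ramM`), `= ∅` for `2a ≤ m`, `m < j + a`, `jl < j + a ≤ …`, `j ≤ jl` (`levelSetDep_eq_empty_of_lt_add_ramM`); the
  `levelSetDep` readers of the named cells: `ncard_levelSetDep_diag_ramM` (D), `ncard_levelSetDep_near_ramM` (K₀ and the near tower).
Q > 2 ∕ general (g, s0): all statements are q-general and (g, s0)-general; the engine rows (q = 2, g = 2, s0 = 1) are CHECKS, not letters (sub-dealer ruling (R-q)).
NOT CLAIMED: purity ∕ coverage ∕ signs ∕ the inter-cell maps of (K-a)(K-b)(K-c) (LH4-p16 (g0), LH4-p09 (g9), cdis1), (K-Σ) (LH4-p04 (g8)).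
HONEST LABEL.  Count-neutral index bookkeeping over ★ tables; nothing printed is asserted; no census law is stated; (β₂) the LETTER is witness-true and UNPROVED; `HC_CM` is
proved only modulo the 7 printed citations (2 remaining named inputs: hLiu418 = `stmt-HodgeConjecture-24832`, h413 = `stmt-HodgeConjecture-24833`) until rung 0 closes.
## References
* [Rogawski1990] J. D. Rogawski, *Automorphic Representations of Unitary Groups in Three Variables*, Ann. of Math. Stud. 123 (1990), §4.9 pp. 55–58, Prop. 4.9.1 (b), Lemma 4.9.3.
* [Kottwitz1986BaseChangeUnits] R. E. Kottwitz, *Base change for unit elements of Hecke algebras*, Compositio Math. 60 (1986), §1 pp. 240–241 (fixed-lattice counts as orbital integrals).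
* [Flicker1998UnitaryFL] Y. Z. Flicker, *Elementary proof of the fundamental lemma for a unitary group*, Canad. J. Math. 50 (1998), Prop. 7 p. 84 (torus-orbit census on the tree).
* [Serre1979] J.-P. Serre, *Local Fields*, GTM 67 (1979), Ch. IV §1–§2; Ch. V §3 Prop. 5, Cor. 2–3 pp. 84–86.
* [Jacobowitz1962] R. Jacobowitz, *Hermitian forms over local fields*, Amer. J. Math. 84 (1962), §4.
-/

set_option autoImplicit false

noncomputable section

open scoped Valued Classical
open WithZero IsLocalRing
open Literature.NumberTheory.Automorphic.UnitaryThreeFourFrame (IsRamifiedQuadraticDatum)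
open Summit.HodgeConjecture.HodgeConjecture.Cruxes.H413.F0P3cDyRamToricCensusDefs
open Summit.HodgeConjecture.HodgeConjecture.Cruxes.H413.F0P3cDyRamToricLevelCensusRamM (levelSetDep_eq_of_generic_ramified ncard_levelSet_eq_hnP ncard_levelSet_eq_hnM)
open Summit.HodgeConjecture.HodgeConjecture.Cruxes.H413.F0P3cDyRamToricLevelCensusRamMAtThirdField (exists_thirdFieldPackage_ramM)
open Summit.HodgeConjecture.HodgeConjecture.Cruxes.H413.F0P3cDyRamClassLettersRamM (hcls0_ramM hclsT_ramM hclsO_ramM hclsE_ramM)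

namespace Summit.HodgeConjecture.HodgeConjecture.Cruxes.H413.F0P3cDyRamConeCellLedgerSizesRamM

variable {K : Type} [Field K] [Valued K ℤᵐ⁰] {ρ Θ : K →+* K}

/-! ## §1 The two ★ T5c tables at the frame (third field and class letters discharged) -/

/-- **THE HYPERBOLIC T5c TABLE AT THE FRAME, TYPE RamM** (★ p858235 `ncard_levelSet_eq_hnP` with (C-0c) the third-field package ★ p857945 and (C-1cls) the class letters
★ p858341 supplied from the frame letters, as in ★ (C-3′)).  Frame: `ρ`, `Θ` commuting isometric involutions with ramified data `(ρ, ϖM, d_ρ)`, `(Θ, ϖM, d_Θ = 2g)` at ONE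
uniformiser `ϖM`, `Θ` residually trivial, the fixed-fixed law `hF4`, the norm clause `hFN`, `ϖE` (`|ϖE| = exp(−2)`, `ρϖE = ϖE`), `#𝓀[K] = q` even, the Klein letter
`2d′ = d_ρ + 2s0` with `|ϖMΘϖM − ρ(ϖMΘϖM)| = exp(−2d′)`, `s0 ≥ 1`; the scalar `h` Θ-fixed, non-zero, ISOTROPIC, with half-order `v_h + d_ρ = 2e`.  Then `#levelSet_h(j, a)` is the
★ `hnP` if-ladder (verbatim). [cite: Rogawski1990, §4.9 pp. 55–58, Prop. 4.9.1 (b), Lemma 4.9.3] [cite: Flicker1998UnitaryFL, Prop. 7 p. 84] [cite: Serre1979, Ch. V §3 Prop. 5, Cor. 2–3 pp. 84–86] -/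
theorem ncard_levelSet_ramM_hyper_of_frame [CompleteSpace K] [IsDiscreteValuationRing 𝒪[K]] [Finite 𝓀[K]]
    (hρρ : ∀ x, ρ (ρ x) = x) (hvρ : ∀ x, Valued.v (ρ x) = Valued.v x)
    (hΘΘ : ∀ x, Θ (Θ x) = x) (hΘρ : ∀ x, Θ (ρ x) = ρ (Θ x)) (hvΘ : ∀ x, Valued.v (Θ x) = Valued.v x)
    (hΘres : ∀ x : K, Valued.v x ≤ 1 → Valued.v (x - Θ x) < 1)
    {ϖM : K} (hϖM : Valued.v ϖM = exp (-1 : ℤ)) {dρ dΘ t : ℕ}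
    (hDρ : IsRamifiedQuadraticDatum ρ ϖM dρ t) (hDΘ : IsRamifiedQuadraticDatum Θ ϖM dΘ t)
    (hF4 : ∀ z : K, ρ z = z → Θ z = z → z ≠ 0 → ∃ n : ℤ, Valued.v z = exp (4 * n))
    (hFN : ∀ f : K, ρ f = f → Θ f = f → Valued.v f = 1 → ∃ z : K, z * Θ z = f)
    {ϖE : K} (hϖE : Valued.v ϖE = exp (-2 : ℤ)) (hρϖ : ρ ϖE = ϖE)
    {q : ℕ} (hq : Nat.card 𝓀[K] = q) (hq2 : 2 ∣ q)
    {g s0 d' : ℕ} (hg2 : dΘ = 2 * g) (hs01 : 1 ≤ s0)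
    (hd'v : Valued.v (ϖM * Θ ϖM - ρ (ϖM * Θ ϖM)) = exp (-(2 * (d' : ℤ)))) (hds : 2 * d' = dρ + 2 * s0)
    {h : K} (hΘh : Θ h = h) (hh : h ≠ 0) (hhyper : ∃ x : K, x ≠ 0 ∧ h * Θ x * x + ρ (h * Θ x * x) = 0)
    {vh e : ℤ} (hvh : Valued.v h = exp (-vh)) (he : vh + dρ = 2 * e) (j a : ℕ) :
    (levelSet ρ Θ ϖM ϖE h j a).ncard =
      (if j = 0 then (if a = 0 then 1 else 0) else if j < a then 0
        else if j - a + 1 = s0 then q ^ j else if j - a + 1 < s0 then (if a = 0 then q ^ j else 0) else if (j - a - s0) % 2 = 1 then 0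
        else if a = 0 then (if 2 * g ≤ j - a - s0 then 2 else 1) * q ^ (j - (j - a - s0) / 2)
        else if j - a - s0 + 2 < 2 * g then (q - 1) * q ^ (j - 1 - (j - a - s0) / 2) else if j - a - s0 + 2 = 2 * g then (q - 2) * q ^ (j - 1 - (j - a - s0) / 2)
        else 2 * (q - 1) * q ^ (j - 1 - (j - a - s0) / 2) : ℕ) := by
  -- (C-0c) the third-field package
  obtain ⟨K', instF', instV', σ', π', jK, instDVR', instFin', hqK', instCS', hσ', hvσ', hfix', hπ', hdd', hjle, hjΘ, hjfixΘ, hjσ, hjπ, -⟩ :=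
    exists_thirdFieldPackage_ramM hρρ hvρ hΘρ hDΘ hΘres hF4 hd'v
  have hqK'q : Nat.card 𝓀[K'] = q := hqK'.trans hq
  -- (C-1cls) the class letters at `P := ϖM·ΘϖM`
  have hΘPcls : Θ (ϖM * Θ ϖM) = ϖM * Θ ϖM := by rw [map_mul, hΘΘ, mul_comm]
  have hvPcls : Valued.v (ϖM * Θ ϖM) = exp (-2 : ℤ) := by rw [map_mul, hvΘ, hϖM, ← exp_add]; rfl
  have hϖMne : ϖM ≠ 0 := fun h0 => by rw [h0, map_zero] at hϖM; exact (WithZero.coe_ne_zero hϖM.symm).elim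
  have hcls0 : ∀ k₀ : ℤ, Valued.v (1 + ρ h / h * (ρ (ϖM ^ k₀ * Θ (ϖM ^ k₀)) / (ϖM ^ k₀ * Θ (ϖM ^ k₀)))) ≤ exp (-(2 * (d' : ℤ) - 2)) :=
    hcls0_ramM hρρ hΘΘ hΘρ hF4 hΘPcls hvPcls hd'v hϖMne hΘh hh
  have hclsT : ∀ k₀ : ℤ, (∃ r : ℤ, k₀ + s0 + e = 2 * r) → ∃ ω₀ : Kˣ, Valued.v (ω₀ : K) = 1 ∧
      ρ h / h * (ρ (ϖM ^ k₀ * Θ (ϖM ^ k₀)) / (ϖM ^ k₀ * Θ (ϖM ^ k₀))) * (ρ ((ω₀ : K) * Θ ω₀) / ((ω₀ : K) * Θ ω₀)) = -1 :=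
    hclsT_ramM hρρ hΘΘ hΘρ hvΘ hF4 hΘPcls hd'v hϖM hϖE hρϖ hΘh hh hvh he hds hhyper
  have hclsO : ∀ k₀ : ℤ, (∃ r : ℤ, k₀ + s0 + e = 2 * r + 1) → ∀ ω : Kˣ, Valued.v (ω : K) = 1 →
      ¬ Valued.v (1 + ρ h / h * (ρ (ϖM ^ k₀ * Θ (ϖM ^ k₀)) / (ϖM ^ k₀ * Θ (ϖM ^ k₀))) * (ρ ((ω : K) * Θ ω) / ((ω : K) * Θ ω))) ≤
        exp (-(2 * (d' : ℤ))) :=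
    hclsO_ramM hρρ hΘΘ hΘρ hvΘ hF4 hΘPcls hvPcls hd'v hϖM hΘh hh hvh he hds
  -- (C-1) the table
  exact ncard_levelSet_eq_hnP hDρ hΘρ hvΘ hϖE hρϖ hq hqK'q hq2 hσ' hvσ' hfix' hπ' hdd' jK hjle hjΘ hjfixΘ hjσ hjπ hDΘ hFN hΘh hh hvh he
    hg2 hds hs01 hcls0 hclsT hclsO j a

/-- **THE ANISOTROPIC T5c TABLE AT THE FRAME, TYPE RamM** (★ p858252 `ncard_levelSet_eq_hnM`, third field ★ p857945, class letters ★ p858341 `hcls0_ramM ∕ hclsE_ramM ∕ hclsO_ramM`).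
Frame as `ncard_levelSet_ramM_hyper_of_frame` plus the Θ-unit dichotomy `(c₀, hdich)` and the anchor non-norm `n₀`; the scalar `h` Θ-fixed, non-zero, ANISOTROPIC.  Then `#levelSet_h(j, a)`
is the ★ `hnM` if-ladder (verbatim). [cite: Rogawski1990, §4.9 pp. 55–58, Prop. 4.9.1 (b), Lemma 4.9.3] [cite: Flicker1998UnitaryFL, Prop. 7 p. 84] [cite: Serre1979, Ch. V §3 Prop. 5, Cor. 2–3 pp. 84–86] -/
theorem ncard_levelSet_ramM_aniso_of_frame [CompleteSpace K] [IsDiscreteValuationRing 𝒪[K]] [Finite 𝓀[K]]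
    (hρρ : ∀ x, ρ (ρ x) = x) (hvρ : ∀ x, Valued.v (ρ x) = Valued.v x)
    (hΘΘ : ∀ x, Θ (Θ x) = x) (hΘρ : ∀ x, Θ (ρ x) = ρ (Θ x)) (hvΘ : ∀ x, Valued.v (Θ x) = Valued.v x)
    (hΘres : ∀ x : K, Valued.v x ≤ 1 → Valued.v (x - Θ x) < 1)
    {ϖM : K} (hϖM : Valued.v ϖM = exp (-1 : ℤ)) {dρ dΘ t : ℕ}
    (hDρ : IsRamifiedQuadraticDatum ρ ϖM dρ t) (hDΘ : IsRamifiedQuadraticDatum Θ ϖM dΘ t)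
    (hF4 : ∀ z : K, ρ z = z → Θ z = z → z ≠ 0 → ∃ n : ℤ, Valued.v z = exp (4 * n))
    (hFN : ∀ f : K, ρ f = f → Θ f = f → Valued.v f = 1 → ∃ z : K, z * Θ z = f)
    {c₀ : K} (hc₀ : Valued.v c₀ = 1) (hdich : ∀ u : K, Θ u = u → Valued.v u = 1 → (∃ z : K, z * Θ z = u) ∨ ∃ z : K, z * Θ z = c₀ * u)
    {n₀ : K} (hΘn₀ : Θ n₀ = n₀) (hn₀1 : Valued.v n₀ = 1) (hn₀N : ¬ ∃ z : K, z * Θ z = n₀)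
    {ϖE : K} (hϖE : Valued.v ϖE = exp (-2 : ℤ)) (hρϖ : ρ ϖE = ϖE)
    {q : ℕ} (hq : Nat.card 𝓀[K] = q)
    {g s0 d' : ℕ} (hg2 : dΘ = 2 * g) (hs01 : 1 ≤ s0)
    (hd'v : Valued.v (ϖM * Θ ϖM - ρ (ϖM * Θ ϖM)) = exp (-(2 * (d' : ℤ)))) (hds : 2 * d' = dρ + 2 * s0)
    {h : K} (hΘh : Θ h = h) (hh : h ≠ 0) (haniso : ¬ ∃ x : K, x ≠ 0 ∧ h * Θ x * x + ρ (h * Θ x * x) = 0)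
    {vh e : ℤ} (hvh : Valued.v h = exp (-vh)) (he : vh + dρ = 2 * e) (j a : ℕ) :
    (levelSet ρ Θ ϖM ϖE h j a).ncard =
      (if j = 0 then (if a = 0 then 1 else 0) else if j < a then 0
        else if j - a + 1 = s0 then q ^ j else if j - a + 1 < s0 then (if a = 0 then q ^ j else 0) else if (j - a - s0) % 2 = 1 then 0
        else if a = 0 then (if j - a - s0 + 2 ≤ 2 * g then q ^ (j - (j - a - s0) / 2) else 0)
        else if j - a - s0 + 2 < 2 * g then (q - 1) * q ^ (j - 1 - (j - a - s0) / 2) else if j - a - s0 + 2 = 2 * g then q ^ (j - (j - a - s0) / 2)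
        else 0 : ℕ) := by
  obtain ⟨K', instF', instV', σ', π', jK, instDVR', instFin', hqK', instCS', hσ', hvσ', hfix', hπ', hdd', hjle, hjΘ, hjfixΘ, hjσ, hjπ, -⟩ :=
    exists_thirdFieldPackage_ramM hρρ hvρ hΘρ hDΘ hΘres hF4 hd'v
  have hqK'q : Nat.card 𝓀[K'] = q := hqK'.trans hq
  have hΘPcls : Θ (ϖM * Θ ϖM) = ϖM * Θ ϖM := by rw [map_mul, hΘΘ, mul_comm]
  have hvPcls : Valued.v (ϖM * Θ ϖM) = exp (-2 : ℤ) := by rw [map_mul, hvΘ, hϖM, ← exp_add]; rfl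
  have hϖMne : ϖM ≠ 0 := fun h0 => by rw [h0, map_zero] at hϖM; exact (WithZero.coe_ne_zero hϖM.symm).elim
  have hcls0 : ∀ k₀ : ℤ, Valued.v (1 + ρ h / h * (ρ (ϖM ^ k₀ * Θ (ϖM ^ k₀)) / (ϖM ^ k₀ * Θ (ϖM ^ k₀)))) ≤ exp (-(2 * (d' : ℤ) - 2)) :=
    hcls0_ramM hρρ hΘΘ hΘρ hF4 hΘPcls hvPcls hd'v hϖMne hΘh hh
  have hclsE : ∀ k₀ : ℤ, (∃ r : ℤ, k₀ + s0 + e = 2 * r) → ∃ ω₀ : Kˣ, Valued.v (ω₀ : K) = 1 ∧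
      ρ h / h * (ρ (ϖM ^ k₀ * Θ (ϖM ^ k₀)) / (ϖM ^ k₀ * Θ (ϖM ^ k₀))) * (ρ ((ω₀ : K) * Θ ω₀) / ((ω₀ : K) * Θ ω₀)) * (ρ n₀ / n₀) = -1 :=
    hclsE_ramM hρρ hΘΘ hΘρ hvΘ hc₀ hdich hΘn₀ hn₀1 hn₀N hΘPcls hd'v hϖM hϖE hρϖ hΘh hh hvh he hds haniso
  have hclsO : ∀ k₀ : ℤ, (∃ r : ℤ, k₀ + s0 + e = 2 * r + 1) → ∀ ω : Kˣ, Valued.v (ω : K) = 1 →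
      ¬ Valued.v (1 + ρ h / h * (ρ (ϖM ^ k₀ * Θ (ϖM ^ k₀)) / (ϖM ^ k₀ * Θ (ϖM ^ k₀))) * (ρ ((ω : K) * Θ ω) / ((ω : K) * Θ ω))) ≤
        exp (-(2 * (d' : ℤ))) :=
    hclsO_ramM hρρ hΘΘ hΘρ hvΘ hF4 hΘPcls hvPcls hd'v hϖM hΘh hh hvh he hds
  exact ncard_levelSet_eq_hnM hDρ hΘρ hvΘ hϖE hρϖ hq hqK'q hσ' hvσ' hfix' hπ' hdd' jK hjle hjΘ hjfixΘ hjσ hjπ hDΘ hFN hΘn₀ hn₀1 hn₀N hΘh hh hvh he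
    hg2 hds hs01 hcls0 hclsE hclsO j a

/-! ## §2 The row readers (`k = j − a − s0`; `a ≥ 1`) -/

/-- **DIAGONAL ROW `k = −1` (`j + 1 = a + s0`), EITHER LITERAL, TYPE RamM: `#levelSet(j, a) = q^j`** for every Θ-fixed non-zero `h` (the ★ `hnP` and ★ `hnM` rows coincide).  Frame of
`ncard_levelSet_ramM_aniso_of_frame` (the dichotomy ∕ anchor letters are used only on the anisotropic branch) + `2 ∣ q`.  At `s0 = 1`, `a = (m−1)∕2`: the refuter's RamM diagonal cell
`D`, `q^a` lattices × weight `q^a` = `2^{ρ₁₃−1}` ✓. [cite: Flicker1998UnitaryFL, Prop. 7 p. 84] [cite: Serre1979, Ch. V §3 Prop. 5, Cor. 2–3 pp. 84–86] [cite: Jacobowitz1962, §4] -/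
theorem ncard_levelSet_diag_ramM [CompleteSpace K] [IsDiscreteValuationRing 𝒪[K]] [Finite 𝓀[K]]
    (hρρ : ∀ x, ρ (ρ x) = x) (hvρ : ∀ x, Valued.v (ρ x) = Valued.v x)
    (hΘΘ : ∀ x, Θ (Θ x) = x) (hΘρ : ∀ x, Θ (ρ x) = ρ (Θ x)) (hvΘ : ∀ x, Valued.v (Θ x) = Valued.v x)
    (hΘres : ∀ x : K, Valued.v x ≤ 1 → Valued.v (x - Θ x) < 1)
    {ϖM : K} (hϖM : Valued.v ϖM = exp (-1 : ℤ)) {dρ dΘ t : ℕ}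
    (hDρ : IsRamifiedQuadraticDatum ρ ϖM dρ t) (hDΘ : IsRamifiedQuadraticDatum Θ ϖM dΘ t)
    (hF4 : ∀ z : K, ρ z = z → Θ z = z → z ≠ 0 → ∃ n : ℤ, Valued.v z = exp (4 * n))
    (hFN : ∀ f : K, ρ f = f → Θ f = f → Valued.v f = 1 → ∃ z : K, z * Θ z = f)
    {c₀ : K} (hc₀ : Valued.v c₀ = 1) (hdich : ∀ u : K, Θ u = u → Valued.v u = 1 → (∃ z : K, z * Θ z = u) ∨ ∃ z : K, z * Θ z = c₀ * u)
    {n₀ : K} (hΘn₀ : Θ n₀ = n₀) (hn₀1 : Valued.v n₀ = 1) (hn₀N : ¬ ∃ z : K, z * Θ z = n₀)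
    {ϖE : K} (hϖE : Valued.v ϖE = exp (-2 : ℤ)) (hρϖ : ρ ϖE = ϖE)
    {q : ℕ} (hq : Nat.card 𝓀[K] = q) (hq2 : 2 ∣ q)
    {g s0 d' : ℕ} (hg2 : dΘ = 2 * g) (hs01 : 1 ≤ s0)
    (hd'v : Valued.v (ϖM * Θ ϖM - ρ (ϖM * Θ ϖM)) = exp (-(2 * (d' : ℤ)))) (hds : 2 * d' = dρ + 2 * s0)
    {h : K} (hΘh : Θ h = h) (hh : h ≠ 0) {vh e : ℤ} (hvh : Valued.v h = exp (-vh)) (he : vh + dρ = 2 * e)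
    {j a : ℕ} (ha : 1 ≤ a) (hdiag : j + 1 = a + s0) :
    (levelSet ρ Θ ϖM ϖE h j a).ncard = q ^ j := by
  by_cases hiso : ∃ x : K, x ≠ 0 ∧ h * Θ x * x + ρ (h * Θ x * x) = 0
  · rw [ncard_levelSet_ramM_hyper_of_frame hρρ hvρ hΘΘ hΘρ hvΘ hΘres hϖM hDρ hDΘ hF4 hFN hϖE hρϖ hq hq2 hg2 hs01 hd'v hds hΘh hh hiso hvh he j a,
      if_neg (by omega), if_neg (by omega), if_pos (by omega)]
  · rw [ncard_levelSet_ramM_aniso_of_frame hρρ hvρ hΘΘ hΘρ hvΘ hΘres hϖM hDρ hDΘ hF4 hFN hc₀ hdich hΘn₀ hn₀1 hn₀N hϖE hρϖ hq hg2 hs01 hd'v hds hΘh hh hiso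
        hvh he j a,
      if_neg (by omega), if_neg (by omega), if_pos (by omega)]

/-- **NEAR ROWS `0 ≤ k`, `k + 2 < 2g`, `k` even, EITHER LITERAL, TYPE RamM: `#levelSet(j, a) = (q − 1)·q^{j − 1 − k∕2}`** (`a ≥ 1`, `a + s0 ≤ j`, `j + 2 < a + s0 + 2g`,
`(j − a − s0)` even).  At `k = 0`: the refuter's `K₀ = ((m+1)∕2, (m−1)∕2)` (s0 = 1, g = 2): `(q−1)q^{j−1}` lattices × weight `q^a` = `2^{ρ₁₃−1}` at q = 2 ✓.
[cite: Flicker1998UnitaryFL, Prop. 7 p. 84] [cite: Serre1979, Ch. V §3 Prop. 5, Cor. 2–3 pp. 84–86] [cite: Jacobowitz1962, §4] -/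
theorem ncard_levelSet_near_ramM [CompleteSpace K] [IsDiscreteValuationRing 𝒪[K]] [Finite 𝓀[K]]
    (hρρ : ∀ x, ρ (ρ x) = x) (hvρ : ∀ x, Valued.v (ρ x) = Valued.v x)
    (hΘΘ : ∀ x, Θ (Θ x) = x) (hΘρ : ∀ x, Θ (ρ x) = ρ (Θ x)) (hvΘ : ∀ x, Valued.v (Θ x) = Valued.v x)
    (hΘres : ∀ x : K, Valued.v x ≤ 1 → Valued.v (x - Θ x) < 1)
    {ϖM : K} (hϖM : Valued.v ϖM = exp (-1 : ℤ)) {dρ dΘ t : ℕ}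
    (hDρ : IsRamifiedQuadraticDatum ρ ϖM dρ t) (hDΘ : IsRamifiedQuadraticDatum Θ ϖM dΘ t)
    (hF4 : ∀ z : K, ρ z = z → Θ z = z → z ≠ 0 → ∃ n : ℤ, Valued.v z = exp (4 * n))
    (hFN : ∀ f : K, ρ f = f → Θ f = f → Valued.v f = 1 → ∃ z : K, z * Θ z = f)
    {c₀ : K} (hc₀ : Valued.v c₀ = 1) (hdich : ∀ u : K, Θ u = u → Valued.v u = 1 → (∃ z : K, z * Θ z = u) ∨ ∃ z : K, z * Θ z = c₀ * u)
    {n₀ : K} (hΘn₀ : Θ n₀ = n₀) (hn₀1 : Valued.v n₀ = 1) (hn₀N : ¬ ∃ z : K, z * Θ z = n₀)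
    {ϖE : K} (hϖE : Valued.v ϖE = exp (-2 : ℤ)) (hρϖ : ρ ϖE = ϖE)
    {q : ℕ} (hq : Nat.card 𝓀[K] = q) (hq2 : 2 ∣ q)
    {g s0 d' : ℕ} (hg2 : dΘ = 2 * g) (hs01 : 1 ≤ s0)
    (hd'v : Valued.v (ϖM * Θ ϖM - ρ (ϖM * Θ ϖM)) = exp (-(2 * (d' : ℤ)))) (hds : 2 * d' = dρ + 2 * s0)
    {h : K} (hΘh : Θ h = h) (hh : h ≠ 0) {vh e : ℤ} (hvh : Valued.v h = exp (-vh)) (he : vh + dρ = 2 * e)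
    {j a : ℕ} (ha : 1 ≤ a) (hk : a + s0 ≤ j) (hnear : j + 2 < a + s0 + 2 * g) (hpar : (j - a - s0) % 2 = 0) :
    (levelSet ρ Θ ϖM ϖE h j a).ncard = (q - 1) * q ^ (j - 1 - (j - a - s0) / 2) := by
  by_cases hiso : ∃ x : K, x ≠ 0 ∧ h * Θ x * x + ρ (h * Θ x * x) = 0
  · rw [ncard_levelSet_ramM_hyper_of_frame hρρ hvρ hΘΘ hΘρ hvΘ hΘres hϖM hDρ hDΘ hF4 hFN hϖE hρϖ hq hq2 hg2 hs01 hd'v hds hΘh hh hiso hvh he j a,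
      if_neg (by omega), if_neg (by omega), if_neg (by omega), if_neg (by omega), if_neg (by omega), if_neg (by omega), if_pos (by omega)]
  · rw [ncard_levelSet_ramM_aniso_of_frame hρρ hvρ hΘΘ hΘρ hvΘ hΘres hϖM hDρ hDΘ hF4 hFN hc₀ hdich hΘn₀ hn₀1 hn₀N hϖE hρϖ hq hg2 hs01 hd'v hds hΘh hh hiso
        hvh he j a,
      if_neg (by omega), if_neg (by omega), if_neg (by omega), if_neg (by omega), if_neg (by omega), if_neg (by omega), if_pos (by omega)]

/-- **BOUNDARY ROW `k + 2 = 2g`, HYPERBOLIC, TYPE RamM: `#levelSet(j, a) = (q − 2)·q^{j − 1 − k∕2}`** (`a ≥ 1`, `j + 2 = a + s0 + 2g`, `g ≥ 1`) — ZERO at q = 2 only.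
[cite: Flicker1998UnitaryFL, Prop. 7 p. 84] [cite: Serre1979, Ch. V §3 Prop. 5, Cor. 2–3 pp. 84–86] -/
theorem ncard_levelSet_boundary_ramM_hyper [CompleteSpace K] [IsDiscreteValuationRing 𝒪[K]] [Finite 𝓀[K]]
    (hρρ : ∀ x, ρ (ρ x) = x) (hvρ : ∀ x, Valued.v (ρ x) = Valued.v x)
    (hΘΘ : ∀ x, Θ (Θ x) = x) (hΘρ : ∀ x, Θ (ρ x) = ρ (Θ x)) (hvΘ : ∀ x, Valued.v (Θ x) = Valued.v x)
    (hΘres : ∀ x : K, Valued.v x ≤ 1 → Valued.v (x - Θ x) < 1)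
    {ϖM : K} (hϖM : Valued.v ϖM = exp (-1 : ℤ)) {dρ dΘ t : ℕ}
    (hDρ : IsRamifiedQuadraticDatum ρ ϖM dρ t) (hDΘ : IsRamifiedQuadraticDatum Θ ϖM dΘ t)
    (hF4 : ∀ z : K, ρ z = z → Θ z = z → z ≠ 0 → ∃ n : ℤ, Valued.v z = exp (4 * n))
    (hFN : ∀ f : K, ρ f = f → Θ f = f → Valued.v f = 1 → ∃ z : K, z * Θ z = f)
    {ϖE : K} (hϖE : Valued.v ϖE = exp (-2 : ℤ)) (hρϖ : ρ ϖE = ϖE)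
    {q : ℕ} (hq : Nat.card 𝓀[K] = q) (hq2 : 2 ∣ q)
    {g s0 d' : ℕ} (hg2 : dΘ = 2 * g) (hg1 : 1 ≤ g) (hs01 : 1 ≤ s0)
    (hd'v : Valued.v (ϖM * Θ ϖM - ρ (ϖM * Θ ϖM)) = exp (-(2 * (d' : ℤ)))) (hds : 2 * d' = dρ + 2 * s0)
    {h : K} (hΘh : Θ h = h) (hh : h ≠ 0) (hhyper : ∃ x : K, x ≠ 0 ∧ h * Θ x * x + ρ (h * Θ x * x) = 0)
    {vh e : ℤ} (hvh : Valued.v h = exp (-vh)) (he : vh + dρ = 2 * e)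
    {j a : ℕ} (ha : 1 ≤ a) (hbdry : j + 2 = a + s0 + 2 * g) :
    (levelSet ρ Θ ϖM ϖE h j a).ncard = (q - 2) * q ^ (j - 1 - (j - a - s0) / 2) := by
  rw [ncard_levelSet_ramM_hyper_of_frame hρρ hvρ hΘΘ hΘρ hvΘ hΘres hϖM hDρ hDΘ hF4 hFN hϖE hρϖ hq hq2 hg2 hs01 hd'v hds hΘh hh hhyper hvh he j a,
    if_neg (by omega), if_neg (by omega), if_neg (by omega), if_neg (by omega), if_neg (by omega), if_neg (by omega), if_neg (by omega), if_pos (by omega)]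

/-- **BOUNDARY ROW `k + 2 = 2g`, ANISOTROPIC, TYPE RamM: `#levelSet(j, a) = q^{j − k∕2}`** (`a ≥ 1`, `j + 2 = a + s0 + 2g`, `g ≥ 1`).  At `s0 = 1`, `g = 2`, `a = (m−1)∕2`: the refuter's first RamM
tower cell (`k = 2`), `q^{a+2}` lattices × weight `q^a` = `4·2^{ρ₁₃−1}` at q = 2 ✓. [cite: Flicker1998UnitaryFL, Prop. 7 p. 84] [cite: Serre1979, Ch. V §3 Prop. 5, Cor. 2–3 pp. 84–86] -/
theorem ncard_levelSet_boundary_ramM_aniso [CompleteSpace K] [IsDiscreteValuationRing 𝒪[K]] [Finite 𝓀[K]]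
    (hρρ : ∀ x, ρ (ρ x) = x) (hvρ : ∀ x, Valued.v (ρ x) = Valued.v x)
    (hΘΘ : ∀ x, Θ (Θ x) = x) (hΘρ : ∀ x, Θ (ρ x) = ρ (Θ x)) (hvΘ : ∀ x, Valued.v (Θ x) = Valued.v x)
    (hΘres : ∀ x : K, Valued.v x ≤ 1 → Valued.v (x - Θ x) < 1)
    {ϖM : K} (hϖM : Valued.v ϖM = exp (-1 : ℤ)) {dρ dΘ t : ℕ}
    (hDρ : IsRamifiedQuadraticDatum ρ ϖM dρ t) (hDΘ : IsRamifiedQuadraticDatum Θ ϖM dΘ t)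
    (hF4 : ∀ z : K, ρ z = z → Θ z = z → z ≠ 0 → ∃ n : ℤ, Valued.v z = exp (4 * n))
    (hFN : ∀ f : K, ρ f = f → Θ f = f → Valued.v f = 1 → ∃ z : K, z * Θ z = f)
    {c₀ : K} (hc₀ : Valued.v c₀ = 1) (hdich : ∀ u : K, Θ u = u → Valued.v u = 1 → (∃ z : K, z * Θ z = u) ∨ ∃ z : K, z * Θ z = c₀ * u)
    {n₀ : K} (hΘn₀ : Θ n₀ = n₀) (hn₀1 : Valued.v n₀ = 1) (hn₀N : ¬ ∃ z : K, z * Θ z = n₀)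
    {ϖE : K} (hϖE : Valued.v ϖE = exp (-2 : ℤ)) (hρϖ : ρ ϖE = ϖE)
    {q : ℕ} (hq : Nat.card 𝓀[K] = q)
    {g s0 d' : ℕ} (hg2 : dΘ = 2 * g) (hg1 : 1 ≤ g) (hs01 : 1 ≤ s0)
    (hd'v : Valued.v (ϖM * Θ ϖM - ρ (ϖM * Θ ϖM)) = exp (-(2 * (d' : ℤ)))) (hds : 2 * d' = dρ + 2 * s0)
    {h : K} (hΘh : Θ h = h) (hh : h ≠ 0) (haniso : ¬ ∃ x : K, x ≠ 0 ∧ h * Θ x * x + ρ (h * Θ x * x) = 0)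
    {vh e : ℤ} (hvh : Valued.v h = exp (-vh)) (he : vh + dρ = 2 * e)
    {j a : ℕ} (ha : 1 ≤ a) (hbdry : j + 2 = a + s0 + 2 * g) :
    (levelSet ρ Θ ϖM ϖE h j a).ncard = q ^ (j - (j - a - s0) / 2) := by
  rw [ncard_levelSet_ramM_aniso_of_frame hρρ hvρ hΘΘ hΘρ hvΘ hΘres hϖM hDρ hDΘ hF4 hFN hc₀ hdich hΘn₀ hn₀1 hn₀N hϖE hρϖ hq hg2 hs01 hd'v hds hΘh hh haniso
      hvh he j a,
    if_neg (by omega), if_neg (by omega), if_neg (by omega), if_neg (by omega), if_neg (by omega), if_neg (by omega), if_neg (by omega), if_pos (by omega)]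

/-- **FAR ROWS `k ≥ 2g` even, HYPERBOLIC, TYPE RamM: `#levelSet(j, a) = 2(q − 1)·q^{j − 1 − k∕2}`** (`a ≥ 1`, `a + s0 + 2g ≤ j`, `(j − a − s0)` even).
[cite: Flicker1998UnitaryFL, Prop. 7 p. 84] [cite: Serre1979, Ch. V §3 Prop. 5, Cor. 2–3 pp. 84–86] -/
theorem ncard_levelSet_far_ramM_hyper [CompleteSpace K] [IsDiscreteValuationRing 𝒪[K]] [Finite 𝓀[K]]
    (hρρ : ∀ x, ρ (ρ x) = x) (hvρ : ∀ x, Valued.v (ρ x) = Valued.v x)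
    (hΘΘ : ∀ x, Θ (Θ x) = x) (hΘρ : ∀ x, Θ (ρ x) = ρ (Θ x)) (hvΘ : ∀ x, Valued.v (Θ x) = Valued.v x)
    (hΘres : ∀ x : K, Valued.v x ≤ 1 → Valued.v (x - Θ x) < 1)
    {ϖM : K} (hϖM : Valued.v ϖM = exp (-1 : ℤ)) {dρ dΘ t : ℕ}
    (hDρ : IsRamifiedQuadraticDatum ρ ϖM dρ t) (hDΘ : IsRamifiedQuadraticDatum Θ ϖM dΘ t)
    (hF4 : ∀ z : K, ρ z = z → Θ z = z → z ≠ 0 → ∃ n : ℤ, Valued.v z = exp (4 * n))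
    (hFN : ∀ f : K, ρ f = f → Θ f = f → Valued.v f = 1 → ∃ z : K, z * Θ z = f)
    {ϖE : K} (hϖE : Valued.v ϖE = exp (-2 : ℤ)) (hρϖ : ρ ϖE = ϖE)
    {q : ℕ} (hq : Nat.card 𝓀[K] = q) (hq2 : 2 ∣ q)
    {g s0 d' : ℕ} (hg2 : dΘ = 2 * g) (hs01 : 1 ≤ s0)
    (hd'v : Valued.v (ϖM * Θ ϖM - ρ (ϖM * Θ ϖM)) = exp (-(2 * (d' : ℤ)))) (hds : 2 * d' = dρ + 2 * s0)
    {h : K} (hΘh : Θ h = h) (hh : h ≠ 0) (hhyper : ∃ x : K, x ≠ 0 ∧ h * Θ x * x + ρ (h * Θ x * x) = 0)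
    {vh e : ℤ} (hvh : Valued.v h = exp (-vh)) (he : vh + dρ = 2 * e)
    {j a : ℕ} (ha : 1 ≤ a) (hfar : a + s0 + 2 * g ≤ j) (hpar : (j - a - s0) % 2 = 0) :
    (levelSet ρ Θ ϖM ϖE h j a).ncard = 2 * (q - 1) * q ^ (j - 1 - (j - a - s0) / 2) := by
  have hg1 : 1 ≤ g := by have h1 := hDΘ.2.2.2.2.2.1; omega
  rw [ncard_levelSet_ramM_hyper_of_frame hρρ hvρ hΘΘ hΘρ hvΘ hΘres hϖM hDρ hDΘ hF4 hFN hϖE hρϖ hq hq2 hg2 hs01 hd'v hds hΘh hh hhyper hvh he j a,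
    if_neg (by omega), if_neg (by omega), if_neg (by omega), if_neg (by omega), if_neg (by omega), if_neg (by omega), if_neg (by omega), if_neg (by omega)]

/-- **FAR ROWS `k ≥ 2g` even, ANISOTROPIC, TYPE RamM: `#levelSet(j, a) = 0`** (`a ≥ 1`, `a + s0 + 2g ≤ j`, `(j − a − s0)` even).
[cite: Flicker1998UnitaryFL, Prop. 7 p. 84] [cite: Serre1979, Ch. V §3 Prop. 5, Cor. 2–3 pp. 84–86] -/
theorem ncard_levelSet_far_ramM_aniso [CompleteSpace K] [IsDiscreteValuationRing 𝒪[K]] [Finite 𝓀[K]]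
    (hρρ : ∀ x, ρ (ρ x) = x) (hvρ : ∀ x, Valued.v (ρ x) = Valued.v x)
    (hΘΘ : ∀ x, Θ (Θ x) = x) (hΘρ : ∀ x, Θ (ρ x) = ρ (Θ x)) (hvΘ : ∀ x, Valued.v (Θ x) = Valued.v x)
    (hΘres : ∀ x : K, Valued.v x ≤ 1 → Valued.v (x - Θ x) < 1)
    {ϖM : K} (hϖM : Valued.v ϖM = exp (-1 : ℤ)) {dρ dΘ t : ℕ}
    (hDρ : IsRamifiedQuadraticDatum ρ ϖM dρ t) (hDΘ : IsRamifiedQuadraticDatum Θ ϖM dΘ t)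
    (hF4 : ∀ z : K, ρ z = z → Θ z = z → z ≠ 0 → ∃ n : ℤ, Valued.v z = exp (4 * n))
    (hFN : ∀ f : K, ρ f = f → Θ f = f → Valued.v f = 1 → ∃ z : K, z * Θ z = f)
    {c₀ : K} (hc₀ : Valued.v c₀ = 1) (hdich : ∀ u : K, Θ u = u → Valued.v u = 1 → (∃ z : K, z * Θ z = u) ∨ ∃ z : K, z * Θ z = c₀ * u)
    {n₀ : K} (hΘn₀ : Θ n₀ = n₀) (hn₀1 : Valued.v n₀ = 1) (hn₀N : ¬ ∃ z : K, z * Θ z = n₀)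
    {ϖE : K} (hϖE : Valued.v ϖE = exp (-2 : ℤ)) (hρϖ : ρ ϖE = ϖE)
    {q : ℕ} (hq : Nat.card 𝓀[K] = q)
    {g s0 d' : ℕ} (hg2 : dΘ = 2 * g) (hs01 : 1 ≤ s0)
    (hd'v : Valued.v (ϖM * Θ ϖM - ρ (ϖM * Θ ϖM)) = exp (-(2 * (d' : ℤ)))) (hds : 2 * d' = dρ + 2 * s0)
    {h : K} (hΘh : Θ h = h) (hh : h ≠ 0) (haniso : ¬ ∃ x : K, x ≠ 0 ∧ h * Θ x * x + ρ (h * Θ x * x) = 0)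
    {vh e : ℤ} (hvh : Valued.v h = exp (-vh)) (he : vh + dρ = 2 * e)
    {j a : ℕ} (ha : 1 ≤ a) (hfar : a + s0 + 2 * g ≤ j) (hpar : (j - a - s0) % 2 = 0) :
    (levelSet ρ Θ ϖM ϖE h j a).ncard = 0 := by
  have hg1 : 1 ≤ g := by have h1 := hDΘ.2.2.2.2.2.1; omega
  rw [ncard_levelSet_ramM_aniso_of_frame hρρ hvρ hΘΘ hΘρ hvΘ hΘres hϖM hDρ hDΘ hF4 hFN hc₀ hdich hΘn₀ hn₀1 hn₀N hϖE hρϖ hq hg2 hs01 hd'v hds hΘh hh haniso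
      hvh he j a,
    if_neg (by omega), if_neg (by omega), if_neg (by omega), if_neg (by omega), if_neg (by omega), if_neg (by omega), if_neg (by omega), if_neg (by omega)]

/-! ## §3 The low-cell depth reduction with the RamM tokens, and the `levelSetDep` readers of the named cells -/

/-- **LOW CELLS PASS THE DEPTH CONDITION WHOLE, TYPE RamM**: in the frame of ★ T5c `…ToricLevelCensusRamMDep` (ρ-datum `(ρ, ϖM, d_ρ)`, `Θ` an isometric involution commuting with `ρ`,
`ρϖE = ϖE`, `|ϖE| = exp(−2)`, `h ≠ 0`) with the tokens `|μ| = |ϖE|^m`, `|μ − ρμ| = |ϖE^{jl}·(ϖM − ρϖM)|`: for `2a ≤ m` and `j + a ≤ jl`, `levelSetDep(j, a; μ) = levelSet(j, a)`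
(★ `levelSetDep_eq_of_generic_ramified`, the generic clause holds). [cite: Jacobowitz1962, §4] [cite: Kottwitz1986BaseChangeUnits, §1 pp. 240–241] -/
theorem levelSetDep_eq_levelSet_of_add_le_ramM {ϖM ϖE h : K} {dρ t : ℕ} (hDρ : IsRamifiedQuadraticDatum ρ ϖM dρ t)
    (hΘΘ : ∀ x, Θ (Θ x) = x) (hΘρ : ∀ x, Θ (ρ x) = ρ (Θ x)) (hvΘ : ∀ x, Valued.v (Θ x) = Valued.v x)
    (hρϖ : ρ ϖE = ϖE) (hϖE : Valued.v ϖE = exp (-2 : ℤ)) (hh : h ≠ 0)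
    {μ : K} {m jl : ℕ} (hμ : Valued.v μ = Valued.v ϖE ^ m) (hjl : Valued.v (μ - ρ μ) = Valued.v (ϖE ^ jl * (ϖM - ρ ϖM)))
    {j a : ℕ} (h2a : 2 * a ≤ m) (hja : j + a ≤ jl) :
    levelSetDep ρ Θ ϖM ϖE h j a μ = levelSet ρ Θ ϖM ϖE h j a := by
  have hG : a ≤ m ∧ (j ≤ m - a ∨ (2 * a ≤ m ∧ j + a ≤ jl)) := ⟨by omega, Or.inr ⟨h2a, hja⟩⟩
  rw [levelSetDep_eq_of_generic_ramified hDρ hΘΘ hΘρ hvΘ hρϖ hϖE hh hμ hjl (by omega) (Or.inr hG), if_pos hG]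

/-- **BEYOND `jl` (AND `m`) A LOW CELL IS EMPTY, TYPE RamM**: `2a ≤ m`, `m < j + a`, `jl < j + a`, `j ≤ jl` ⇒ `levelSetDep(j, a; μ) = ∅` (off the diagonal automatically; the generic
clause fails) — the RamM tower stops at `k = δ := jl − m`… in the cell letters `j + a = jl`. [cite: Jacobowitz1962, §4] [cite: Kottwitz1986BaseChangeUnits, §1 pp. 240–241] -/
theorem levelSetDep_eq_empty_of_lt_add_ramM {ϖM ϖE h : K} {dρ t : ℕ} (hDρ : IsRamifiedQuadraticDatum ρ ϖM dρ t)
    (hΘΘ : ∀ x, Θ (Θ x) = x) (hΘρ : ∀ x, Θ (ρ x) = ρ (Θ x)) (hvΘ : ∀ x, Valued.v (Θ x) = Valued.v x)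
    (hρϖ : ρ ϖE = ϖE) (hϖE : Valued.v ϖE = exp (-2 : ℤ)) (hh : h ≠ 0)
    {μ : K} {m jl : ℕ} (hμ : Valued.v μ = Valued.v ϖE ^ m) (hjl : Valued.v (μ - ρ μ) = Valued.v (ϖE ^ jl * (ϖM - ρ ϖM)))
    {j a : ℕ} (h2a : 2 * a ≤ m) (hmj : m < j + a) (hjlj : jl < j + a) (hj : j ≤ jl) :
    levelSetDep ρ Θ ϖM ϖE h j a μ = ∅ := by
  have hoff : j + m ≠ jl + a := by omega
  rw [levelSetDep_eq_of_generic_ramified hDρ hΘΘ hΘρ hvΘ hρϖ hϖE hh hμ hjl hj (Or.inl hoff), if_neg (by omega)]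

/-- **THE DIAGONAL CELL WITH TOKENS, EITHER LITERAL, TYPE RamM: `#levelSetDep(j, a; μ) = q^j`** (`a ≥ 1`, `j + 1 = a + s0`, `2a ≤ m`, `j + a ≤ jl`; frame of `ncard_levelSet_diag_ramM` +
the tokens).  At `s0 = 1`: `#D = q^{(m−1)∕2}` for the refuter's `D = ((m−1)∕2, (m−1)∕2)`. [cite: Flicker1998UnitaryFL, Prop. 7 p. 84] [cite: Kottwitz1986BaseChangeUnits, §1 pp. 240–241] -/
theorem ncard_levelSetDep_diag_ramM [CompleteSpace K] [IsDiscreteValuationRing 𝒪[K]] [Finite 𝓀[K]]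
    (hρρ : ∀ x, ρ (ρ x) = x) (hvρ : ∀ x, Valued.v (ρ x) = Valued.v x)
    (hΘΘ : ∀ x, Θ (Θ x) = x) (hΘρ : ∀ x, Θ (ρ x) = ρ (Θ x)) (hvΘ : ∀ x, Valued.v (Θ x) = Valued.v x)
    (hΘres : ∀ x : K, Valued.v x ≤ 1 → Valued.v (x - Θ x) < 1)
    {ϖM : K} (hϖM : Valued.v ϖM = exp (-1 : ℤ)) {dρ dΘ t : ℕ}
    (hDρ : IsRamifiedQuadraticDatum ρ ϖM dρ t) (hDΘ : IsRamifiedQuadraticDatum Θ ϖM dΘ t)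
    (hF4 : ∀ z : K, ρ z = z → Θ z = z → z ≠ 0 → ∃ n : ℤ, Valued.v z = exp (4 * n))
    (hFN : ∀ f : K, ρ f = f → Θ f = f → Valued.v f = 1 → ∃ z : K, z * Θ z = f)
    {c₀ : K} (hc₀ : Valued.v c₀ = 1) (hdich : ∀ u : K, Θ u = u → Valued.v u = 1 → (∃ z : K, z * Θ z = u) ∨ ∃ z : K, z * Θ z = c₀ * u)
    {n₀ : K} (hΘn₀ : Θ n₀ = n₀) (hn₀1 : Valued.v n₀ = 1) (hn₀N : ¬ ∃ z : K, z * Θ z = n₀)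
    {ϖE : K} (hϖE : Valued.v ϖE = exp (-2 : ℤ)) (hρϖ : ρ ϖE = ϖE)
    {q : ℕ} (hq : Nat.card 𝓀[K] = q) (hq2 : 2 ∣ q)
    {g s0 d' : ℕ} (hg2 : dΘ = 2 * g) (hs01 : 1 ≤ s0)
    (hd'v : Valued.v (ϖM * Θ ϖM - ρ (ϖM * Θ ϖM)) = exp (-(2 * (d' : ℤ)))) (hds : 2 * d' = dρ + 2 * s0)
    {h : K} (hΘh : Θ h = h) (hh : h ≠ 0) {vh e : ℤ} (hvh : Valued.v h = exp (-vh)) (he : vh + dρ = 2 * e)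
    {μ : K} {m jl : ℕ} (hμ : Valued.v μ = Valued.v ϖE ^ m) (hjl : Valued.v (μ - ρ μ) = Valued.v (ϖE ^ jl * (ϖM - ρ ϖM)))
    {j a : ℕ} (ha : 1 ≤ a) (hdiag : j + 1 = a + s0) (h2a : 2 * a ≤ m) (hja : j + a ≤ jl) :
    (levelSetDep ρ Θ ϖM ϖE h j a μ).ncard = q ^ j := by
  rw [levelSetDep_eq_levelSet_of_add_le_ramM hDρ hΘΘ hΘρ hvΘ hρϖ hϖE hh hμ hjl h2a hja]
  exact ncard_levelSet_diag_ramM hρρ hvρ hΘΘ hΘρ hvΘ hΘres hϖM hDρ hDΘ hF4 hFN hc₀ hdich hΘn₀ hn₀1 hn₀N hϖE hρϖ hq hq2 hg2 hs01 hd'v hds hΘh hh hvh he ha hdiag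

/-- **THE NEAR CELLS WITH TOKENS, EITHER LITERAL, TYPE RamM: `#levelSetDep(j, a; μ) = (q − 1)·q^{j − 1 − k∕2}`** (`a ≥ 1`, `a + s0 ≤ j`, `j + 2 < a + s0 + 2g`, `k` even, `2a ≤ m`,
`j + a ≤ jl`).  At `k = 0`, `s0 = 1`: the refuter's `K₀`. [cite: Flicker1998UnitaryFL, Prop. 7 p. 84] [cite: Kottwitz1986BaseChangeUnits, §1 pp. 240–241] -/
theorem ncard_levelSetDep_near_ramM [CompleteSpace K] [IsDiscreteValuationRing 𝒪[K]] [Finite 𝓀[K]]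
    (hρρ : ∀ x, ρ (ρ x) = x) (hvρ : ∀ x, Valued.v (ρ x) = Valued.v x)
    (hΘΘ : ∀ x, Θ (Θ x) = x) (hΘρ : ∀ x, Θ (ρ x) = ρ (Θ x)) (hvΘ : ∀ x, Valued.v (Θ x) = Valued.v x)
    (hΘres : ∀ x : K, Valued.v x ≤ 1 → Valued.v (x - Θ x) < 1)
    {ϖM : K} (hϖM : Valued.v ϖM = exp (-1 : ℤ)) {dρ dΘ t : ℕ}
    (hDρ : IsRamifiedQuadraticDatum ρ ϖM dρ t) (hDΘ : IsRamifiedQuadraticDatum Θ ϖM dΘ t)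
    (hF4 : ∀ z : K, ρ z = z → Θ z = z → z ≠ 0 → ∃ n : ℤ, Valued.v z = exp (4 * n))
    (hFN : ∀ f : K, ρ f = f → Θ f = f → Valued.v f = 1 → ∃ z : K, z * Θ z = f)
    {c₀ : K} (hc₀ : Valued.v c₀ = 1) (hdich : ∀ u : K, Θ u = u → Valued.v u = 1 → (∃ z : K, z * Θ z = u) ∨ ∃ z : K, z * Θ z = c₀ * u)
    {n₀ : K} (hΘn₀ : Θ n₀ = n₀) (hn₀1 : Valued.v n₀ = 1) (hn₀N : ¬ ∃ z : K, z * Θ z = n₀)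
    {ϖE : K} (hϖE : Valued.v ϖE = exp (-2 : ℤ)) (hρϖ : ρ ϖE = ϖE)
    {q : ℕ} (hq : Nat.card 𝓀[K] = q) (hq2 : 2 ∣ q)
    {g s0 d' : ℕ} (hg2 : dΘ = 2 * g) (hs01 : 1 ≤ s0)
    (hd'v : Valued.v (ϖM * Θ ϖM - ρ (ϖM * Θ ϖM)) = exp (-(2 * (d' : ℤ)))) (hds : 2 * d' = dρ + 2 * s0)
    {h : K} (hΘh : Θ h = h) (hh : h ≠ 0) {vh e : ℤ} (hvh : Valued.v h = exp (-vh)) (he : vh + dρ = 2 * e)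
    {μ : K} {m jl : ℕ} (hμ : Valued.v μ = Valued.v ϖE ^ m) (hjl : Valued.v (μ - ρ μ) = Valued.v (ϖE ^ jl * (ϖM - ρ ϖM)))
    {j a : ℕ} (ha : 1 ≤ a) (hk : a + s0 ≤ j) (hnear : j + 2 < a + s0 + 2 * g) (hpar : (j - a - s0) % 2 = 0) (h2a : 2 * a ≤ m) (hja : j + a ≤ jl) :
    (levelSetDep ρ Θ ϖM ϖE h j a μ).ncard = (q - 1) * q ^ (j - 1 - (j - a - s0) / 2) := by
  rw [levelSetDep_eq_levelSet_of_add_le_ramM hDρ hΘΘ hΘρ hvΘ hρϖ hϖE hh hμ hjl h2a hja]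
  exact ncard_levelSet_near_ramM hρρ hvρ hΘΘ hΘρ hvΘ hΘres hϖM hDρ hDΘ hF4 hFN hc₀ hdich hΘn₀ hn₀1 hn₀N hϖE hρϖ hq hq2 hg2 hs01 hd'v hds hΘh hh hvh he
    ha hk hnear hpar

end Summit.HodgeConjecture.HodgeConjecture.Cruxes.H413.F0P3cDyRamConeCellLedgerSizesRamM

end
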